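import Mathlib
import HarnessLib

/-!
# Approximating `1/(1 - tz)` and `(1 - tx)/(1 + t² - 2tx)`: Rivlin, Exercises 2.4.15–2.4.18

Source: T. J. Rivlin, *The Chebyshev Polynomials*, Wiley 1974 (held scan
`book:rivlinnd-chebyshev-polynomials`, bib key `Rivlin1974`), Sect. 2.4 Exercises 2.4.15–2.4.18,
p. 49 of the scan.

The text (`0 < t < 1`, `D` the closed unit disc, `C` the unit circle, `I = [-1, 1]`).
* Ex. 2.4.15: `w(z) = (z - t)/(1 - tz)` maps `C` onto `|w| = 1` (with a monotone argument).
* Ex. 2.4.16: for `f(z) = 1/(1 - tz)` and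
  `p*(z) = 1 + tz + ⋯ + t^{n-1} z^{n-1} + (1 - t²)^{-1} t^n z^n`,
  `r = f - p* = t^{n+1} (1 - t²)^{-1} z^n (z - t)/(1 - tz)` and `E(r; D) = C` (the modulus of `r`
  is constant on `C`, so every point of `C` is an extremal point).
* Ex. 2.4.17: `p*` is the best approximation to `f` on `D` out of `𝒫_n` and
  `E_n(f) = t^{n+1}/(1 - t²)`.
* Ex. 2.4.18: the best approximation to `g(x) = (1 - tx)/(1 + t² - 2tx)` on `I` out of `𝒫_n` is
  `p = 1 + t T_1 + ⋯ + t^{n-1} T_{n-1} + (1 - t²)^{-1} t^n T_n` (hint: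
  `Re r(e^{iθ}) = [t^{n+1}/(1 - t²)] cos (nθ + φ)`).

What is here — the algebra and the error identities, i.e. everything except the two optimality
claims (which need the Kolmogorov criterion / the alternation theorem and the monotone-argument
half of Ex. 2.4.15, NOT typed):
* Ex. 2.4.15 (modulus part): `normSq_sub_ofReal_sub_normSq_one_sub_mul`
  (`|z - t|² - |1 - tz|² = (|z|² - 1)(1 - t²)`), hence `|z - t| = |1 - tz|` on `C`
  (`norm_sub_ofReal_eq_of_norm_eq_one`), `|z - t| ≤ |1 - tz|` on `D` for `|t| ≤ 1`
  (`norm_sub_ofReal_le_of_norm_le_one`) and `1 - tz ≠ 0` on `D` for `|t| < 1`.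
* Ex. 2.4.16: the remainder identity over any field (`inv_one_sub_mul_sub_truncation`), the constant
  modulus `|r(z)| = t^{n+1}/(1 - t²)` on `C` (`norm_blaschkeRemainder_eq`) and — the upper-bound
  half of Ex. 2.4.17 — `|r(z)| ≤ t^{n+1}/(1 - t²)` on `D` (`norm_blaschkeRemainder_le`).
* Ex. 2.4.18: Rivlin's polynomial `geometricChebyshevPoly t n`, the real sections
  `re_inv_one_sub_mul_exp` (`Re f(e^{iθ}) = g(cos θ)`), `re_truncation_exp`
  (`Re p*(e^{iθ}) = p(cos θ)`), `kernel_sub_eval_eq_re` (`g(cos θ) - p(cos θ) = Re r(e^{iθ})`), the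
  error bound `abs_kernel_sub_eval_le` (`|g(x) - p(x)| ≤ t^{n+1}/(1 - t²)` on `I`), the endpoint
  values `kernel_sub_eval_one` (`= t^{n+1}/(1 - t²)`), `kernel_sub_eval_neg_one`
  (`= (-t)^{n+1}/(1 - t²)`), and `isGreatest_abs_kernel_sub_eval`: `‖g - p‖_I = t^{n+1}/(1 - t²)`.

Honest framing: shared numerical engines serving client cells; rigour lives in the verifiers; every
published number belongs to a client cell's ledger, not to the engines group.
-/

open Polynomial Polynomial.Chebyshev Finset Complex

namespace Literature.Analysis.Approximation.BlaschkeFactorApproximation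

/-! ### Ex. 2.4.15: the Blaschke factor `(z - t)/(1 - tz)` -/

/-- Ex. 2.4.15, the identity behind the Blaschke factor: for real `t`,
`|z - t|² - |1 - tz|² = (|z|² - 1)(1 - t²)`. [cite: Rivlin1974, Sect. 2.4 Ex. 2.4.15] -/
theorem normSq_sub_ofReal_sub_normSq_one_sub_mul (t : ℝ) (z : ℂ) :
    normSq (z - t) - normSq (1 - t * z) = (normSq z - 1) * (1 - t ^ 2) := by
  simp only [normSq_apply, sub_re, sub_im, ofReal_re, ofReal_im, one_re, one_im, mul_re, mul_im]
  ring

/-- Ex. 2.4.15 (modulus part): `w(z) = (z - t)/(1 - tz)` maps `|z| = 1` into `|w| = 1`, i.e.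
`|z - t| = |1 - tz|` for `|z| = 1`. [cite: Rivlin1974, Sect. 2.4 Ex. 2.4.15] -/
theorem norm_sub_ofReal_eq_of_norm_eq_one (t : ℝ) {z : ℂ} (hz : ‖z‖ = 1) :
    ‖z - t‖ = ‖1 - t * z‖ := by
  have h := normSq_sub_ofReal_sub_normSq_one_sub_mul t z
  rw [normSq_eq_norm_sq z, hz, one_pow, sub_self, zero_mul, sub_eq_zero, normSq_eq_norm_sq,
    normSq_eq_norm_sq] at h
  exact (sq_eq_sq₀ (norm_nonneg _) (norm_nonneg _)).mp h

/-- The Blaschke factor is bounded by `1` on the closed disc: `|z - t| ≤ |1 - tz|` for `|z| ≤ 1`,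
`|t| ≤ 1`. [cite: Rivlin1974, Sect. 2.4 Ex. 2.4.15, Ex. 2.4.17] -/
theorem norm_sub_ofReal_le_of_norm_le_one {t : ℝ} (ht : |t| ≤ 1) {z : ℂ} (hz : ‖z‖ ≤ 1) :
    ‖z - t‖ ≤ ‖1 - t * z‖ := by
  have h := normSq_sub_ofReal_sub_normSq_one_sub_mul t z
  have hle : normSq (z - t) ≤ normSq (1 - t * z) := by
    have h1 : normSq z - 1 ≤ 0 := by
      rw [normSq_eq_norm_sq]; nlinarith [norm_nonneg z]
    have h2 : 0 ≤ 1 - t ^ 2 := by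
      have := abs_le.mp ht; nlinarith
    nlinarith [mul_nonpos_of_nonpos_of_nonneg h1 h2]
  rw [normSq_eq_norm_sq, normSq_eq_norm_sq] at hle
  exact (sq_le_sq₀ (norm_nonneg _) (norm_nonneg _)).mp hle

/-- For `|t| < 1` the pole `z = 1/t` of `f(z) = 1/(1 - tz)` lies outside the closed unit disc:
`1 - tz ≠ 0` for `|z| ≤ 1`. [cite: Rivlin1974, Sect. 2.4 Ex. 2.4.16] -/
theorem one_sub_ofReal_mul_ne_zero {t : ℝ} (ht : |t| < 1) {z : ℂ} (hz : ‖z‖ ≤ 1) :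
    (1 : ℂ) - t * z ≠ 0 := by
  intro h
  have h1 : ‖(t : ℂ) * z‖ = 1 := by rw [← sub_eq_zero.mp h]; simp
  rw [norm_mul, norm_real, Real.norm_eq_abs] at h1
  have : |t| * ‖z‖ ≤ |t| * 1 := mul_le_mul_of_nonneg_left hz (abs_nonneg t)
  linarith

/-! ### Ex. 2.4.16–2.4.17: the remainder `r = f - p*` -/

/-- Ex. 2.4.16, the remainder identity (over any field, `1 - tz ≠ 0`, `1 - t² ≠ 0`):
`1/(1 - tz) - (1 + tz + ⋯ + t^{n-1} z^{n-1} + t^n z^n/(1 - t²))`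
`= t^{n+1} z^n (z - t)/((1 - tz)(1 - t²))`. [cite: Rivlin1974, Sect. 2.4 Ex. 2.4.16] -/
theorem inv_one_sub_mul_sub_truncation {K : Type*} [Field K] (t z : K) (n : ℕ)
    (h1 : 1 - t * z ≠ 0) (h2 : 1 - t ^ 2 ≠ 0) :
    (1 - t * z)⁻¹ - (∑ k ∈ range n, t ^ k * z ^ k + t ^ n / (1 - t ^ 2) * z ^ n)
      = t ^ (n + 1) * z ^ n * (z - t) / ((1 - t * z) * (1 - t ^ 2)) := by
  have hg : (∑ k ∈ range n, t ^ k * z ^ k) * (1 - t * z) = 1 - t ^ n * z ^ n := by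
    have := geom_sum_mul_neg (t * z) n
    simp_rw [mul_pow] at this
    exact this
  apply mul_right_cancel₀ (mul_ne_zero h1 h2)
  rw [div_mul_cancel₀ _ (mul_ne_zero h1 h2), sub_mul, add_mul,
    show (1 - t * z)⁻¹ * ((1 - t * z) * (1 - t ^ 2)) = 1 - t ^ 2 by
      rw [← mul_assoc, inv_mul_cancel₀ h1, one_mul],
    show (∑ k ∈ range n, t ^ k * z ^ k) * ((1 - t * z) * (1 - t ^ 2))
      = (1 - t ^ n * z ^ n) * (1 - t ^ 2) by rw [← mul_assoc, hg],
    show t ^ n / (1 - t ^ 2) * z ^ n * ((1 - t * z) * (1 - t ^ 2)) = t ^ n * z ^ n * (1 - t * z) by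
      rw [div_mul_eq_mul_div, div_mul_eq_mul_div, div_eq_iff h2]; ring]
  ring

/-- Ex. 2.4.16, `E(r; D) = C`: on the unit circle the remainder has constant modulus
`|r(z)| = t^{n+1}/(1 - t²)` (`0 ≤ t < 1`). [cite: Rivlin1974, Sect. 2.4 Ex. 2.4.16] -/
theorem norm_blaschkeRemainder_eq {t : ℝ} (ht0 : 0 ≤ t) (ht1 : t < 1) {z : ℂ} (hz : ‖z‖ = 1)
    (n : ℕ) :
    ‖(t : ℂ) ^ (n + 1) * z ^ n * (z - t) / ((1 - t * z) * (1 - (t : ℂ) ^ 2))‖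
      = t ^ (n + 1) / (1 - t ^ 2) := by
  have ht : |t| < 1 := abs_lt.mpr ⟨by linarith, ht1⟩
  have hne := one_sub_ofReal_mul_ne_zero ht hz.le
  have h2 : (0 : ℝ) < 1 - t ^ 2 := by nlinarith
  rw [norm_div, norm_mul, norm_mul, norm_mul, norm_pow, norm_pow, hz, one_pow, mul_one,
    norm_real, Real.norm_eq_abs, abs_of_nonneg ht0, norm_sub_ofReal_eq_of_norm_eq_one t hz,
    show (1 : ℂ) - (t : ℂ) ^ 2 = ((1 - t ^ 2 : ℝ) : ℂ) by push_cast; ring, norm_real,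
    Real.norm_eq_abs, abs_of_pos h2, mul_comm (t ^ (n + 1)),
    mul_div_mul_left _ _ (norm_ne_zero_iff.mpr hne)]

/-- Ex. 2.4.17, upper-bound half: `|r(z)| ≤ t^{n+1}/(1 - t²)` on the closed unit disc, so
`E_n(f) ≤ ‖f - p*‖_D = t^{n+1}/(1 - t²)` (the optimality of `p*` is not typed).
[cite: Rivlin1974, Sect. 2.4 Ex. 2.4.17] -/
theorem norm_blaschkeRemainder_le {t : ℝ} (ht0 : 0 ≤ t) (ht1 : t < 1) {z : ℂ} (hz : ‖z‖ ≤ 1)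
    (n : ℕ) :
    ‖(t : ℂ) ^ (n + 1) * z ^ n * (z - t) / ((1 - t * z) * (1 - (t : ℂ) ^ 2))‖
      ≤ t ^ (n + 1) / (1 - t ^ 2) := by
  have ht : |t| < 1 := abs_lt.mpr ⟨by linarith, ht1⟩
  have hne := one_sub_ofReal_mul_ne_zero ht hz
  have h2 : (0 : ℝ) < 1 - t ^ 2 := by nlinarith
  rw [norm_div, norm_mul, norm_mul, norm_mul, norm_pow, norm_pow, norm_real, Real.norm_eq_abs,
    abs_of_nonneg ht0,
    show (1 : ℂ) - (t : ℂ) ^ 2 = ((1 - t ^ 2 : ℝ) : ℂ) by push_cast; ring, norm_real,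
    Real.norm_eq_abs, abs_of_pos h2, div_le_div_iff₀ (mul_pos (norm_pos_iff.mpr hne) h2) h2]
  have hzn : ‖z‖ ^ n ≤ 1 := pow_le_one₀ (norm_nonneg _) hz
  have hb := norm_sub_ofReal_le_of_norm_le_one ht.le hz
  have htp : 0 ≤ t ^ (n + 1) := pow_nonneg ht0 _
  have h2' : 0 ≤ 1 - t ^ 2 := h2.le
  calc t ^ (n + 1) * ‖z‖ ^ n * ‖z - (t : ℂ)‖ * (1 - t ^ 2)
      ≤ t ^ (n + 1) * 1 * ‖1 - (t : ℂ) * z‖ * (1 - t ^ 2) := by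
        gcongr
    _ = t ^ (n + 1) * (‖1 - (t : ℂ) * z‖ * (1 - t ^ 2)) := by ring

/-! ### Ex. 2.4.18: the real section `g(x) = (1 - tx)/(1 + t² - 2tx)` on `[-1, 1]` -/

/-- Ex. 2.4.18, Rivlin's polynomial `p = 1 + t T_1 + ⋯ + t^{n-1} T_{n-1} + (1 - t²)^{-1} t^n T_n`.
[cite: Rivlin1974, Sect. 2.4 Ex. 2.4.18] -/
noncomputable def geometricChebyshevPoly (t : ℝ) (n : ℕ) : ℝ[X] :=
  ∑ k ∈ range n, Polynomial.C (t ^ k) * T ℝ k + Polynomial.C (t ^ n / (1 - t ^ 2)) * T ℝ n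

/-- The real section of `f`: `Re 1/(1 - t e^{iθ}) = (1 - t cos θ)/(1 + t² - 2t cos θ) = g(cos θ)`.
[cite: Rivlin1974, Sect. 2.4 Ex. 2.4.18; Sect. 1.5 (1.105)] -/
theorem re_inv_one_sub_mul_exp (t θ : ℝ) :
    ((1 - (t : ℂ) * exp (θ * I))⁻¹).re
      = (1 - t * Real.cos θ) / (1 + t ^ 2 - 2 * t * Real.cos θ) := by
  have h1 : (1 - (t : ℂ) * exp (θ * I)).re = 1 - t * Real.cos θ := by
    rw [sub_re, one_re, re_ofReal_mul, exp_ofReal_mul_I_re]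
  have h2 : (1 - (t : ℂ) * exp (θ * I)).im = -(t * Real.sin θ) := by
    rw [sub_im, one_im, im_ofReal_mul, exp_ofReal_mul_I_im, zero_sub]
  rw [inv_re, normSq_apply, h1, h2]
  congr 1
  linear_combination t ^ 2 * Real.sin_sq_add_cos_sq θ

/-- The real section of `p*`: `Re p*(e^{iθ}) = p(cos θ)` with `p = geometricChebyshevPoly t n`
(`Re (t e^{iθ})^k = t^k cos kθ = t^k T_k(cos θ)`). [cite: Rivlin1974, Sect. 2.4 Ex. 2.4.18] -/
theorem re_truncation_exp (t θ : ℝ) (n : ℕ) :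
    (∑ k ∈ range n, (t : ℂ) ^ k * exp (θ * I) ^ k
        + (t : ℂ) ^ n / (1 - (t : ℂ) ^ 2) * exp (θ * I) ^ n).re
      = (geometricChebyshevPoly t n).eval (Real.cos θ) := by
  have hk : ∀ k : ℕ, ((t : ℂ) ^ k * exp (θ * I) ^ k).re = t ^ k * (T ℝ k).eval (Real.cos θ) := by
    intro k
    rw [← ofReal_pow, re_ofReal_mul, ← exp_nat_mul, ← mul_assoc,
      show ((k : ℂ) * (θ : ℂ)) = ((k * θ : ℝ) : ℂ) by push_cast; ring, exp_ofReal_mul_I_re,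
      T_real_cos]
    norm_cast
  rw [geometricChebyshevPoly, add_re, re_sum, eval_add, eval_finsetSum]
  congr 1
  · exact sum_congr rfl fun k _ => by rw [hk, eval_mul, eval_C]
  · rw [show (t : ℂ) ^ n / (1 - (t : ℂ) ^ 2) = ((t ^ n / (1 - t ^ 2) : ℝ) : ℂ) by push_cast; ring,
      show ((t ^ n / (1 - t ^ 2) : ℝ) : ℂ) * exp (θ * I) ^ n
        = ((1 / (1 - t ^ 2) : ℝ) : ℂ) * ((t : ℂ) ^ n * exp (θ * I) ^ n) by push_cast; ring,
      re_ofReal_mul, hk, eval_mul, eval_C]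
    ring

/-- Ex. 2.4.18 (hint): `g(cos θ) - p(cos θ) = Re r(e^{iθ})` for `0 ≤ t < 1`.
[cite: Rivlin1974, Sect. 2.4 Ex. 2.4.18 (hint)] -/
theorem kernel_sub_eval_eq_re {t : ℝ} (ht0 : 0 ≤ t) (ht1 : t < 1) (θ : ℝ) (n : ℕ) :
    (1 - t * Real.cos θ) / (1 + t ^ 2 - 2 * t * Real.cos θ)
        - (geometricChebyshevPoly t n).eval (Real.cos θ)
      = ((t : ℂ) ^ (n + 1) * exp (θ * I) ^ n * (exp (θ * I) - t)
          / ((1 - t * exp (θ * I)) * (1 - (t : ℂ) ^ 2))).re := by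
  have ht : |t| < 1 := abs_lt.mpr ⟨by linarith, ht1⟩
  have hz : ‖exp (θ * I)‖ = 1 := norm_exp_ofReal_mul_I θ
  have h1 := one_sub_ofReal_mul_ne_zero ht hz.le
  have h2 : (1 : ℂ) - (t : ℂ) ^ 2 ≠ 0 := by
    rw [show (1 : ℂ) - (t : ℂ) ^ 2 = ((1 - t ^ 2 : ℝ) : ℂ) by push_cast; ring, ofReal_ne_zero]
    nlinarith
  rw [← inv_one_sub_mul_sub_truncation (t : ℂ) (exp (θ * I)) n h1 h2, sub_re,
    re_inv_one_sub_mul_exp, re_truncation_exp]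

/-- Ex. 2.4.18, error bound: `|g(x) - p(x)| ≤ t^{n+1}/(1 - t²)` for `x ∈ [-1, 1]`, `0 ≤ t < 1`.
[cite: Rivlin1974, Sect. 2.4 Ex. 2.4.18] -/
theorem abs_kernel_sub_eval_le {t : ℝ} (ht0 : 0 ≤ t) (ht1 : t < 1) (n : ℕ) {x : ℝ}
    (hx : x ∈ Set.Icc (-1 : ℝ) 1) :
    |(1 - t * x) / (1 + t ^ 2 - 2 * t * x) - (geometricChebyshevPoly t n).eval x|
      ≤ t ^ (n + 1) / (1 - t ^ 2) := by
  obtain ⟨θ, -, rfl⟩ : ∃ θ : ℝ, θ ∈ Set.Icc 0 Real.pi ∧ Real.cos θ = x :=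
    ⟨Real.arccos x, ⟨Real.arccos_nonneg x, Real.arccos_le_pi x⟩, Real.cos_arccos hx.1 hx.2⟩
  rw [kernel_sub_eval_eq_re ht0 ht1 θ n]
  refine (abs_re_le_norm _).trans ?_
  rw [norm_blaschkeRemainder_eq ht0 ht1 (norm_exp_ofReal_mul_I θ) n]

/-- `p(1) = 1 + t + ⋯ + t^{n-1} + t^n/(1 - t²)`. [cite: Rivlin1974, Sect. 2.4 Ex. 2.4.18] -/
theorem geometricChebyshevPoly_eval_one (t : ℝ) (n : ℕ) :
    (geometricChebyshevPoly t n).eval 1 = ∑ k ∈ range n, t ^ k + t ^ n / (1 - t ^ 2) := by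
  rw [geometricChebyshevPoly, eval_add, eval_finsetSum]
  simp only [eval_mul, eval_C, T_eval_one, mul_one]

/-- `p(-1) = Σ_{k<n} (-t)^k + (-t)^n/(1 - t²)` (`T_k(-1) = (-1)^k`).
[cite: Rivlin1974, Sect. 2.4 Ex. 2.4.18] -/
theorem geometricChebyshevPoly_eval_neg_one (t : ℝ) (n : ℕ) :
    (geometricChebyshevPoly t n).eval (-1) = ∑ k ∈ range n, (-t) ^ k + (-t) ^ n / (1 - t ^ 2) := by
  have hT : ∀ k : ℕ, (T ℝ k).eval (-1) = (-1) ^ k := fun k => by simp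
  rw [geometricChebyshevPoly, eval_add, eval_finsetSum]
  simp only [eval_mul, eval_C, hT]
  congr 1
  · exact sum_congr rfl fun k _ => by rw [mul_comm, ← neg_pow]
  · rw [div_mul_eq_mul_div, mul_comm (t ^ n), ← neg_pow]

/-- Ex. 2.4.18 at `x = 1` (`θ = 0`, an extremal point): `g(1) - p(1) = t^{n+1}/(1 - t²)`.
[cite: Rivlin1974, Sect. 2.4 Ex. 2.4.18] -/
theorem kernel_sub_eval_one {t : ℝ} (ht1 : t ≠ 1) (ht2 : t ≠ -1) (n : ℕ) :
    (1 - t * 1) / (1 + t ^ 2 - 2 * t * 1) - (geometricChebyshevPoly t n).eval 1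
      = t ^ (n + 1) / (1 - t ^ 2) := by
  have h1 : (1 : ℝ) - t ≠ 0 := sub_ne_zero.mpr (Ne.symm ht1)
  have h2 : (1 : ℝ) + t ≠ 0 := by intro h; apply ht2; linarith
  have hg : ∑ k ∈ range n, t ^ k = (1 - t ^ n) / (1 - t) := by
    rw [eq_div_iff h1, geom_sum_mul_neg]
  rw [geometricChebyshevPoly_eval_one, hg,
    show (1 : ℝ) + t ^ 2 - 2 * t * 1 = (1 - t) * (1 - t) by ring,
    show (1 : ℝ) - t ^ 2 = (1 - t) * (1 + t) by ring]
  field_simp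
  ring

/-- Ex. 2.4.18 at `x = -1` (`θ = π`, an extremal point of the opposite parity):
`g(-1) - p(-1) = (-t)^{n+1}/(1 - t²)`. [cite: Rivlin1974, Sect. 2.4 Ex. 2.4.18] -/
theorem kernel_sub_eval_neg_one {t : ℝ} (ht1 : t ≠ 1) (ht2 : t ≠ -1) (n : ℕ) :
    (1 - t * (-1)) / (1 + t ^ 2 - 2 * t * (-1)) - (geometricChebyshevPoly t n).eval (-1)
      = (-t) ^ (n + 1) / (1 - t ^ 2) := by
  have h1 : (1 : ℝ) - t ≠ 0 := sub_ne_zero.mpr (Ne.symm ht1)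
  have h2 : (1 : ℝ) + t ≠ 0 := by intro h; apply ht2; linarith
  have hg : ∑ k ∈ range n, (-t) ^ k = (1 - (-t) ^ n) / (1 + t) := by
    rw [eq_div_iff h2, show (1 : ℝ) + t = 1 - (-t) by ring, geom_sum_mul_neg]
  rw [geometricChebyshevPoly_eval_neg_one, hg,
    show (1 : ℝ) + t ^ 2 - 2 * t * (-1) = (1 + t) * (1 + t) by ring,
    show (1 : ℝ) - t ^ 2 = (1 - t) * (1 + t) by ring, pow_succ]
  field_simp
  ring

/-- Ex. 2.4.18, the value of the deviation: `max_{x ∈ I} |g(x) - p(x)| = t^{n+1}/(1 - t²)`, attained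
at `x = 1` (that this is `E_n(g)`, i.e. that `p` is the best approximation, is not typed).
[cite: Rivlin1974, Sect. 2.4 Ex. 2.4.18] -/
theorem isGreatest_abs_kernel_sub_eval {t : ℝ} (ht0 : 0 ≤ t) (ht1 : t < 1) (n : ℕ) :
    IsGreatest ((fun x => |(1 - t * x) / (1 + t ^ 2 - 2 * t * x)
        - (geometricChebyshevPoly t n).eval x|) '' Set.Icc (-1 : ℝ) 1)
      (t ^ (n + 1) / (1 - t ^ 2)) := by
  refine ⟨⟨1, ⟨by norm_num, le_rfl⟩, ?_⟩, ?_⟩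
  · simp only
    rw [kernel_sub_eval_one ht1.ne (by linarith) n, abs_of_nonneg]
    exact div_nonneg (pow_nonneg ht0 _) (by nlinarith)
  · rintro _ ⟨x, hx, rfl⟩
    exact abs_kernel_sub_eval_le ht0 ht1 n hx

end Literature.Analysis.Approximation.BlaschkeFactorApproximation
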